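import Summits.RiemannHypothesis.RiemannHypothesis.Theorems.JensenPolynomialsPhiCells
import Summits.RiemannHypothesis.RiemannHypothesis.Theorems.JensenPolynomialsPhiHigherDeriv
import Literature.NumberTheory.LFunctions.XiTiltedPotential

/-!
# Route `JensenPolynomials`, crux `XiDeltaSqPos` (S-T5) — Csordas–Varga's monotonicity of `−Φ′(u)/(uΦ(u))`
on `(0, 1/4]`, PROVED zero-free from the kernel interval certificate (RH-FREE; cell rh-jensen, HUMAN RULING D-0040)

The route's crux item `XiDeltaSqPos` (`Δ(M)² > 0` for all `M ≥ 2`, the strict Turán inequalities of `ξ`'s Taylor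
data) was reduced in `JensenPolynomialsXiDeltaSqPosOfLogConcaveSqrt.lean` (Chebyshev covariance + integration by parts)
to ONE analytic statement about the Pólya–de Bruijn kernel near `0`: `u ↦ −Φ′(u)/(uΦ(u))` is non-decreasing on
`(0, 1/4]` (the half `[1/4, ∞)` is that file's envelope argument). This file PROVES the statement — Csordas–Varga 1988,
Theorem 2.2 (`log Φ(√t)` strictly concave; "a lengthy construction (10 lemmas) establishing bounds for `Φ^{(j)}`,
`j ≤ 6`, on `(0, 0.03] ∪ [0.03, 0.06] ∪ [0.056, ∞)`", Varga 1990 §3.3 (3.5)) — in the kernel: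

* §1 `Φ^{(m)}(u) = eᵘF_m(e^{4u})` for `m ≤ 4` (`F_m = phiSeries m`, the theta series of toolboxes 3–4);
* §2 the ranges of `y₀ = πe^{4u}` on the three regimes (`Real.pi_gt_d20`/`pi_lt_d20`, `Real.quadratic_le_exp_of_nonneg`,
  `expPosHi`);
* §3 `T = −Φ²Φ‴ + 3ΦΦ′Φ″ − 2Φ′³ = V′Φ³` (`V = −(log Φ)″ = phiNegLogDeriv₂`): `T(0) = 0` (parity), `T′ = e^{3u}·formA > 0`
  on `[0, 0.045]` (certificate `formA_pos_on`, 20 cells) hence `T ≥ 0` there; `T = e^{3u}·formT > 0` on `[0.045, 0.11]`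
  (`formT_pos_on`, 36 cells);
* §4 hence `V` is non-decreasing on `[0, 0.11]`, so `L = −Φ′/Φ` (`L(0) = 0`, `L′ = V`) is convex there and `L(u)/u` is
  non-decreasing on `(0, 0.11]`;
* §5 on `[0.11, 1/4]`: `(L(u)/u)′ = N/(u²Φ²)` with `N = u(Φ′² − ΦΦ″) + ΦΦ′ = e^{2u}·formN > 0` (`formN_pos_on`, 73 cells);
* §6 union: `monotoneOn_negPhiDeriv_div_quarter` — `u ↦ −Φ′(u)/(uΦ(u))` is non-decreasing on `(0, 1/4]`.

The item closer (`xiDeltaSqPos_item`) and the discharge of the Literature named fact `DeBruijnPhiLogConcaveSqrt` are the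
next file (they need the reduction file). Axioms standard (the certificate is `decide +kernel`); import closure
zero-free and height-free. WHAT THIS IS NOT: nothing here bears on the zeros of `ζ`.

References: Csordas–Norfolk–Varga, Trans. AMS 296 (1986) [CsordasNorfolkVarga1986]; Csordas–Varga, Constr. Approx. 4
(1988), Thm 2.2 [CsordasVarga1988]; Varga, SIAM CBMS 60 (1990), §3.3 [Varga1990]; Coffey–Csordas, Math. Comp. 82 (2013)
[CoffeyCsordas2013].
-/

-- D-0017: `Summit.RiemannHypothesis.RiemannHypothesis.…` duplicates the namespace BY DESIGN (single-problem summit).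
set_option linter.dupNamespace false

namespace Summit.RiemannHypothesis.RiemannHypothesis.Theorems.JensenPolynomials

open Literature.NumberTheory.LFunctions CoeffTable Set
open scoped Real

/-! ## 1. The derivatives of `Φ` as the series `F_m`: `Φ^{(m)}(u) = eᵘ F_m(e^{4u})` -/

/-- `P₀` term. -/
theorem phiPolyTerm_eq_qterm₀ (x : ℝ) (n : ℕ) : phiPolyTerm (-3) 2 0 0 x n = qterm (Qc 0) x n := by
  simp only [phiPolyTerm, qterm, Qc, pevalR]; push_cast; ring

/-- `P₁` term (the toolbox writes `Φ′ = −eᵘ∑(15y − 30y² + 8y³)e^{−y}`). -/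
theorem phiPolyTerm_eq_qterm₁ (x : ℝ) (n : ℕ) : phiPolyTerm 15 (-30) 8 0 x n = -qterm (Qc 1) x n := by
  simp only [phiPolyTerm, qterm, Qc, pevalR]; push_cast; ring

/-- `P₂` term. -/
theorem phiPolyTerm_eq_qterm₂ (x : ℝ) (n : ℕ) : phiPolyTerm (-75) 330 (-224) 32 x n = qterm (Qc 2) x n := by
  simp only [phiPolyTerm, qterm, Qc, pevalR]; push_cast; ring

/-- `P₃` term. -/
theorem phiPolyTerm6_eq_qterm₃ (x : ℝ) (n : ℕ) :
    phiPolyTerm6 (-375) 3270 (-4232) 1440 (-128) 0 x n = qterm (Qc 3) x n := by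
  simp only [phiPolyTerm6, qterm, Qc, pevalR]; push_cast; ring

/-- `P₄` term. -/
theorem phiPolyTerm6_eq_qterm₄ (x : ℝ) (n : ℕ) :
    phiPolyTerm6 (-1875) 30930 (-68096) 41408 (-8448) 512 x n = qterm (Qc 4) x n := by
  simp only [phiPolyTerm6, qterm, Qc, pevalR]; push_cast; ring

/-- `Φ(u) = eᵘ F₀(e^{4u})`. -/
theorem deBruijnPhi_eq_phiSeries (u : ℝ) : deBruijnPhi u = rexp u * phiSeries 0 (rexp (4 * u)) := by
  rw [deBruijnPhi_eq_tsum, phiSeries, tsum_congr (phiPolyTerm_eq_qterm₀ _)]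

/-- `Φ′(u) = eᵘ F₁(e^{4u})`. -/
theorem deBruijnPhiDeriv_eq_phiSeries (u : ℝ) : deBruijnPhiDeriv u = rexp u * phiSeries 1 (rexp (4 * u)) := by
  rw [deBruijnPhiDeriv_eq_tsum, phiSeries, tsum_congr (phiPolyTerm_eq_qterm₁ _), tsum_neg]; ring

/-- `Φ″(u) = eᵘ F₂(e^{4u})`. -/
theorem deBruijnPhiDeriv₂_eq_phiSeries (u : ℝ) : deBruijnPhiDeriv₂ u = rexp u * phiSeries 2 (rexp (4 * u)) := by
  rw [deBruijnPhiDeriv₂_eq_tsum, phiSeries, tsum_congr (phiPolyTerm_eq_qterm₂ _)]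

/-- `Φ‴(u) = eᵘ F₃(e^{4u})`. -/
theorem deBruijnPhiDeriv₃_eq_phiSeries (u : ℝ) : deBruijnPhiDeriv₃ u = rexp u * phiSeries 3 (rexp (4 * u)) := by
  rw [deBruijnPhiDeriv₃_eq_tsum, phiSeries, tsum_congr (phiPolyTerm6_eq_qterm₃ _)]

/-- `Φ⁗(u) = eᵘ F₄(e^{4u})`. -/
theorem deBruijnPhiDeriv₄_eq_phiSeries (u : ℝ) : deBruijnPhiDeriv₄ u = rexp u * phiSeries 4 (rexp (4 * u)) := by
  rw [deBruijnPhiDeriv₄_eq_tsum, phiSeries, tsum_congr (phiPolyTerm6_eq_qterm₄ _)]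

/-- `y₀(e^{4u}) = πe^{4u}`. -/
theorem thetaFreq_exp_zero (u : ℝ) : thetaFreq (rexp (4 * u)) 0 = π * rexp (4 * u) := by
  simp [thetaFreq]

/-! ## 2. The ranges of `y₀ = πe^{4u}` on the three `u`-regimes -/

/-- `π ≤ piHi`. -/
theorem pi_le_piHi : π ≤ ((piHi : ℚ) : ℝ) := by
  have := Real.pi_lt_d20; unfold piHi; push_cast; linarith

/-- Upper range: `πe^{4u} ≤ piHi·expPosHi(4b)` for `u ≤ b`, `0 ≤ 4b ≤ 1`. -/
theorem thetaFreq_exp_le (b : ℚ) (hb0 : 0 ≤ 4 * b) (hb1 : 4 * b ≤ 1) {u : ℝ} (hub : u ≤ (b : ℝ)) :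
    thetaFreq (rexp (4 * u)) 0 ≤ ((piHi * expPosHi (4 * b) : ℚ) : ℝ) := by
  rw [thetaFreq_exp_zero]
  have h1 : rexp (4 * u) ≤ rexp (((4 * b : ℚ) : ℝ)) := Real.exp_le_exp.2 (by push_cast; linarith)
  have h2 := exp_le_expPosHi hb0 hb1
  push_cast
  exact mul_le_mul pi_le_piHi (h1.trans h2) (Real.exp_pos _).le (le_trans Real.pi_pos.le pi_le_piHi)

/-- Lower range: `πe^{4u} ≥ 3.14159265358979323846·(1 + 4a + 8a²)` for `u ≥ a ≥ 0`. -/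
theorem le_thetaFreq_exp {u a : ℝ} (hau : a ≤ u) (ha : 0 ≤ a) :
    3.14159265358979323846 * (1 + 4 * a + (4 * a) ^ 2 / 2) ≤ thetaFreq (rexp (4 * u)) 0 := by
  rw [thetaFreq_exp_zero]
  have h1 : 1 + 4 * a + (4 * a) ^ 2 / 2 ≤ rexp (4 * u) :=
    (Real.quadratic_le_exp_of_nonneg (by linarith)).trans (Real.exp_le_exp.2 (by linarith))
  have h0 : (0 : ℝ) ≤ 1 + 4 * a + (4 * a) ^ 2 / 2 := by positivity
  exact mul_le_mul Real.pi_gt_d20.le h1 h0 Real.pi_pos.le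

/-! ## 3. Regime A and T: `T = −Φ²Φ‴ + 3ΦΦ′Φ″ − 2Φ′³ ≥ 0` on `[0, 11/100]` -/

/-- The derivative of `T = −Φ²Φ‴ + 3ΦΦ′Φ″ − 2Φ′³`: `T′ = −Φ²Φ⁗ + ΦΦ′Φ‴ + 3ΦΦ″² − 3Φ′²Φ″`. -/
theorem hasDerivAt_turanT (u : ℝ) :
    HasDerivAt (fun u => -(deBruijnPhi u ^ 2 * deBruijnPhiDeriv₃ u) +
        3 * deBruijnPhi u * deBruijnPhiDeriv u * deBruijnPhiDeriv₂ u - 2 * deBruijnPhiDeriv u ^ 3)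
      (-(deBruijnPhi u ^ 2 * deBruijnPhiDeriv₄ u) + deBruijnPhi u * deBruijnPhiDeriv u * deBruijnPhiDeriv₃ u +
        3 * deBruijnPhi u * deBruijnPhiDeriv₂ u ^ 2 - 3 * deBruijnPhiDeriv u ^ 2 * deBruijnPhiDeriv₂ u) u := by
  have h0 := hasDerivAt_deBruijnPhi u
  have h1 := hasDerivAt_deBruijnPhiDeriv u
  have h2 := hasDerivAt_deBruijnPhiDeriv₂ u
  have h3 := hasDerivAt_deBruijnPhiDeriv₃ u
  have hA := (h0.fun_mul h0).fun_mul h3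
  have hB := ((h0.const_mul 3).fun_mul h1).fun_mul h2
  have hC := ((h1.fun_mul h1).fun_mul h1).const_mul 2
  have h := (hA.fun_neg.fun_add hB).fun_sub hC
  have ef : (fun u => -(deBruijnPhi u ^ 2 * deBruijnPhiDeriv₃ u) +
        3 * deBruijnPhi u * deBruijnPhiDeriv u * deBruijnPhiDeriv₂ u - 2 * deBruijnPhiDeriv u ^ 3) =
      (fun y => -(deBruijnPhi y * deBruijnPhi y * deBruijnPhiDeriv₃ y) +
        3 * deBruijnPhi y * deBruijnPhiDeriv y * deBruijnPhiDeriv₂ y -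
        2 * (deBruijnPhiDeriv y * deBruijnPhiDeriv y * deBruijnPhiDeriv y)) := by
    funext y; ring
  rw [ef]
  exact h.congr_deriv (by ring)

/-- `T(0) = 0` (`Φ′(0) = Φ‴(0) = 0` by parity). -/
theorem turanT_zero : -(deBruijnPhi 0 ^ 2 * deBruijnPhiDeriv₃ 0) +
    3 * deBruijnPhi 0 * deBruijnPhiDeriv 0 * deBruijnPhiDeriv₂ 0 - 2 * deBruijnPhiDeriv 0 ^ 3 = 0 := by
  have h1 : deBruijnPhiDeriv 0 = 0 := by
    have h := deBruijnPhiDeriv_neg 0; rw [neg_zero] at h; linarith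
  rw [h1, deBruijnPhiDeriv₃_zero]; ring

/-- `T′(u) = e^{3u}·(−F₀²F₄ + F₀F₁F₃ + 3F₀F₂² − 3F₁²F₂)(e^{4u})`. -/
theorem turanT'_eq (u : ℝ) :
    -(deBruijnPhi u ^ 2 * deBruijnPhiDeriv₄ u) + deBruijnPhi u * deBruijnPhiDeriv u * deBruijnPhiDeriv₃ u +
        3 * deBruijnPhi u * deBruijnPhiDeriv₂ u ^ 2 - 3 * deBruijnPhiDeriv u ^ 2 * deBruijnPhiDeriv₂ u =
      rexp u ^ 3 * (-(phiSeries 0 (rexp (4 * u)) ^ 2 * phiSeries 4 (rexp (4 * u))) +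
        phiSeries 0 (rexp (4 * u)) * phiSeries 1 (rexp (4 * u)) * phiSeries 3 (rexp (4 * u)) +
        3 * phiSeries 0 (rexp (4 * u)) * phiSeries 2 (rexp (4 * u)) ^ 2 -
        3 * phiSeries 1 (rexp (4 * u)) ^ 2 * phiSeries 2 (rexp (4 * u))) := by
  rw [deBruijnPhi_eq_phiSeries, deBruijnPhiDeriv_eq_phiSeries, deBruijnPhiDeriv₂_eq_phiSeries,
    deBruijnPhiDeriv₃_eq_phiSeries, deBruijnPhiDeriv₄_eq_phiSeries]; ring

/-- `T(u) = e^{3u}·(−F₀²F₃ + 3F₀F₁F₂ − 2F₁³)(e^{4u})`. -/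
theorem turanT_eq (u : ℝ) :
    -(deBruijnPhi u ^ 2 * deBruijnPhiDeriv₃ u) +
        3 * deBruijnPhi u * deBruijnPhiDeriv u * deBruijnPhiDeriv₂ u - 2 * deBruijnPhiDeriv u ^ 3 =
      rexp u ^ 3 * (-(phiSeries 0 (rexp (4 * u)) ^ 2 * phiSeries 3 (rexp (4 * u))) +
        3 * phiSeries 0 (rexp (4 * u)) * phiSeries 1 (rexp (4 * u)) * phiSeries 2 (rexp (4 * u)) -
        2 * phiSeries 1 (rexp (4 * u)) ^ 3) := by
  rw [deBruijnPhi_eq_phiSeries, deBruijnPhiDeriv_eq_phiSeries, deBruijnPhiDeriv₂_eq_phiSeries,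
    deBruijnPhiDeriv₃_eq_phiSeries]; ring

/-- Regime A: `T′(u) > 0` for `0 ≤ u ≤ 0.045` (kernel certificate `formA_pos_on`). -/
theorem turanT'_pos {u : ℝ} (hu0 : 0 ≤ u) (hu1 : u ≤ 9 / 200) :
    0 < -(deBruijnPhi u ^ 2 * deBruijnPhiDeriv₄ u) + deBruijnPhi u * deBruijnPhiDeriv u * deBruijnPhiDeriv₃ u +
        3 * deBruijnPhi u * deBruijnPhiDeriv₂ u ^ 2 - 3 * deBruijnPhiDeriv u ^ 2 * deBruijnPhiDeriv₂ u := by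
  rw [turanT'_eq]
  refine mul_pos (pow_pos (Real.exp_pos u) 3) (formA_pos_on (Real.exp_pos _) ?_ ?_)
  · have h := le_thetaFreq_exp hu0 le_rfl
    push_cast; linarith
  · have h := thetaFreq_exp_le (9 / 200) (by norm_num) (by norm_num) (u := u) (by push_cast; linarith)
    exact h.trans (by exact_mod_cast (by decide +kernel : piHi * expPosHi (4 * (9 / 200)) ≤ (753 / 200 : ℚ)))

/-- Regime T: `T(u) > 0` for `0.045 ≤ u ≤ 0.11` (kernel certificate `formT_pos_on`). -/
theorem turanT_pos_mid {u : ℝ} (hu0 : 9 / 200 ≤ u) (hu1 : u ≤ 11 / 100) :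
    0 < -(deBruijnPhi u ^ 2 * deBruijnPhiDeriv₃ u) +
        3 * deBruijnPhi u * deBruijnPhiDeriv u * deBruijnPhiDeriv₂ u - 2 * deBruijnPhiDeriv u ^ 3 := by
  rw [turanT_eq]
  refine mul_pos (pow_pos (Real.exp_pos u) 3) (formT_pos_on (Real.exp_pos _) ?_ ?_)
  · have h := le_thetaFreq_exp hu0 (by norm_num)
    exact le_trans (by norm_num) h
  · have h := thetaFreq_exp_le (11 / 100) (by norm_num) (by norm_num) (u := u) (by push_cast; linarith)
    exact h.trans (by exact_mod_cast (by decide +kernel : piHi * expPosHi (4 * (11 / 100)) ≤ (489 / 100 : ℚ)))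

/-- `T(u) ≥ 0` on `[0, 0.11]`: on `[0, 0.045]` from `T(0) = 0` and `T′ > 0`, on `[0.045, 0.11]` directly. -/
theorem turanT_nonneg {u : ℝ} (hu0 : 0 ≤ u) (hu1 : u ≤ 11 / 100) :
    0 ≤ -(deBruijnPhi u ^ 2 * deBruijnPhiDeriv₃ u) +
        3 * deBruijnPhi u * deBruijnPhiDeriv u * deBruijnPhiDeriv₂ u - 2 * deBruijnPhiDeriv u ^ 3 := by
  rcases le_or_gt u (9 / 200) with hsmall | hbig
  · -- monotone on `[0, 0.045]` from the positive derivative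
    have hmono : MonotoneOn (fun u => -(deBruijnPhi u ^ 2 * deBruijnPhiDeriv₃ u) +
        3 * deBruijnPhi u * deBruijnPhiDeriv u * deBruijnPhiDeriv₂ u - 2 * deBruijnPhiDeriv u ^ 3) (Icc 0 (9 / 200)) := by
      refine monotoneOn_of_deriv_nonneg (convex_Icc _ _)
        (fun v _ => (hasDerivAt_turanT v).continuousAt.continuousWithinAt)
        (fun v _ => (hasDerivAt_turanT v).differentiableAt.differentiableWithinAt) ?_
      intro v hv
      rw [interior_Icc] at hv
      rw [(hasDerivAt_turanT v).deriv]
      exact (turanT'_pos hv.1.le hv.2.le).le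
    have h := hmono (show (0 : ℝ) ∈ Icc (0 : ℝ) (9 / 200) from ⟨le_rfl, by norm_num⟩) ⟨hu0, hsmall⟩ hu0
    simp only at h
    rw [turanT_zero] at h
    exact h
  · exact (turanT_pos_mid hbig.le hu1).le

/-! ## 4. `V = −(log Φ)″` is non-decreasing on `[0, 0.11]`, hence `L(u)/u` is on `(0, 0.11]` -/

/-- `V′ = T/Φ³`. -/
theorem hasDerivAt_phiNegLogDeriv₂ (u : ℝ) :
    HasDerivAt phiNegLogDeriv₂ ((-(deBruijnPhi u ^ 2 * deBruijnPhiDeriv₃ u) +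
        3 * deBruijnPhi u * deBruijnPhiDeriv u * deBruijnPhiDeriv₂ u - 2 * deBruijnPhiDeriv u ^ 3) /
        deBruijnPhi u ^ 3) u := by
  have h0 := hasDerivAt_deBruijnPhi u
  have h1 := hasDerivAt_deBruijnPhiDeriv u
  have h2 := hasDerivAt_deBruijnPhiDeriv₂ u
  have hΦ : deBruijnPhi u ≠ 0 := (deBruijnPhi_pos_holds u).ne'
  have hnum := (h1.fun_mul h1).fun_sub (h0.fun_mul h2)
  have hden := h0.fun_mul h0
  have h := hnum.div hden (mul_ne_zero hΦ hΦ)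
  have ef : phiNegLogDeriv₂ = fun t => (deBruijnPhiDeriv t * deBruijnPhiDeriv t - deBruijnPhi t * deBruijnPhiDeriv₂ t) /
      (deBruijnPhi t * deBruijnPhi t) := by
    funext t; simp only [phiNegLogDeriv₂]; ring
  rw [ef]
  refine h.congr_deriv ?_
  field_simp
  ring

/-- `V` is non-decreasing on `[0, 0.11]`. -/
theorem monotoneOn_phiNegLogDeriv₂ : MonotoneOn phiNegLogDeriv₂ (Icc 0 (11 / 100)) := by
  refine monotoneOn_of_deriv_nonneg (convex_Icc _ _)
    (fun v _ => (hasDerivAt_phiNegLogDeriv₂ v).continuousAt.continuousWithinAt)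
    (fun v _ => (hasDerivAt_phiNegLogDeriv₂ v).differentiableAt.differentiableWithinAt) ?_
  intro v hv
  rw [interior_Icc] at hv
  rw [(hasDerivAt_phiNegLogDeriv₂ v).deriv]
  exact div_nonneg (turanT_nonneg hv.1.le hv.2.le) (pow_pos (deBruijnPhi_pos_holds v) 3).le

/-- `u ↦ −Φ′(u)/(uΦ(u)) = L(u)/u` is non-decreasing on `(0, 0.11]` (`L` is convex on `[0, 0.11]` with `L(0) = 0`, so its
chord slopes from `0` increase; the argument of `xiDeltaSqPos_of_monotoneOn_logConcavity` on the shorter window). -/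
theorem monotoneOn_negPhiDeriv_div_small :
    MonotoneOn (fun u : ℝ => -deBruijnPhiDeriv u / (u * deBruijnPhi u)) (Ioc 0 (11 / 100)) := by
  have hconv : ConvexOn ℝ (Icc (0 : ℝ) (11 / 100)) phiNegLogDeriv := by
    refine MonotoneOn.convexOn_of_deriv (convex_Icc 0 (11 / 100)) continuous_phiNegLogDeriv.continuousOn
      (fun x _ => (hasDerivAt_phiNegLogDeriv x).differentiableAt.differentiableWithinAt) ?_
    rw [deriv_phiNegLogDeriv, interior_Icc]
    exact monotoneOn_phiNegLogDeriv₂.mono Ioo_subset_Icc_self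
  intro s hs t ht hst
  have hs0 : 0 < s := hs.1
  have ht0 : 0 < t := ht.1
  have hgs : -deBruijnPhiDeriv s / (s * deBruijnPhi s) = phiNegLogDeriv s / s := by
    simp only [phiNegLogDeriv]; rw [div_div, mul_comm]
  have hgt : -deBruijnPhiDeriv t / (t * deBruijnPhi t) = phiNegLogDeriv t / t := by
    simp only [phiNegLogDeriv]; rw [div_div, mul_comm]
  show -deBruijnPhiDeriv s / (s * deBruijnPhi s) ≤ -deBruijnPhiDeriv t / (t * deBruijnPhi t)
  rw [hgs, hgt]
  rcases eq_or_lt_of_le hst with rfl | hlt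
  · exact le_rfl
  have hslope := hconv.slope_mono_adjacent (x := 0) (y := s) (z := t)
    (Set.mem_Icc.2 ⟨le_rfl, by norm_num⟩) (Set.mem_Icc.2 ⟨ht0.le, ht.2⟩) hs0 hlt
  rw [phiNegLogDeriv_zero, sub_zero, sub_zero] at hslope
  rw [div_le_div_iff₀ hs0 ht0]
  have hts : 0 < t - s := by linarith
  rw [div_le_div_iff₀ hs0 hts] at hslope
  nlinarith [hslope]

/-! ## 5. Regime N: `N = u(Φ′² − ΦΦ″) + ΦΦ′ > 0` on `[0.11, 1/4]`, hence `L(u)/u` is increasing there -/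

/-- `N(u) = e^{2u}·(u(F₁² − F₀F₂) + F₀F₁)(e^{4u})`. -/
theorem turanN_eq (u : ℝ) :
    u * (deBruijnPhiDeriv u ^ 2 - deBruijnPhi u * deBruijnPhiDeriv₂ u) + deBruijnPhi u * deBruijnPhiDeriv u =
      rexp u ^ 2 * (u * (phiSeries 1 (rexp (4 * u)) ^ 2 - phiSeries 0 (rexp (4 * u)) * phiSeries 2 (rexp (4 * u))) +
        phiSeries 0 (rexp (4 * u)) * phiSeries 1 (rexp (4 * u))) := by
  rw [deBruijnPhi_eq_phiSeries, deBruijnPhiDeriv_eq_phiSeries, deBruijnPhiDeriv₂_eq_phiSeries]; ring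

/-- Regime N: `N(u) > 0` for `0.11 ≤ u ≤ 1/4` (kernel certificate `formN_pos_on`). -/
theorem turanN_pos {u : ℝ} (hu0 : 11 / 100 ≤ u) (hu1 : u ≤ 1 / 4) :
    0 < u * (deBruijnPhiDeriv u ^ 2 - deBruijnPhi u * deBruijnPhiDeriv₂ u) + deBruijnPhi u * deBruijnPhiDeriv u := by
  rw [turanN_eq]
  refine mul_pos (pow_pos (Real.exp_pos u) 2) (formN_pos_on ?_ ?_)
  · have h := le_thetaFreq_exp hu0 (by norm_num)
    exact le_trans (by norm_num) h
  · have h := thetaFreq_exp_le (1 / 4) (by norm_num) (by norm_num) (u := u) (by push_cast; linarith)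
    exact h.trans (by exact_mod_cast (by decide +kernel : piHi * expPosHi (4 * (1 / 4)) ≤ (1709 / 200 : ℚ)))

/-- The derivative of `u ↦ L(u)/u`: `(uV(u) − L(u))/u²`. -/
theorem hasDerivAt_phiNegLogDeriv_div {u : ℝ} (hu : u ≠ 0) :
    HasDerivAt (fun a : ℝ => phiNegLogDeriv a / a) ((phiNegLogDeriv₂ u * u - phiNegLogDeriv u * 1) / u ^ 2) u :=
  (hasDerivAt_phiNegLogDeriv u).div (hasDerivAt_id u) hu

/-- `uV(u) − L(u) = N(u)/Φ(u)²`. -/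
theorem mul_phiNegLogDeriv₂_sub (u : ℝ) :
    phiNegLogDeriv₂ u * u - phiNegLogDeriv u * 1 =
      (u * (deBruijnPhiDeriv u ^ 2 - deBruijnPhi u * deBruijnPhiDeriv₂ u) + deBruijnPhi u * deBruijnPhiDeriv u) /
        deBruijnPhi u ^ 2 := by
  have hΦ : deBruijnPhi u ≠ 0 := (deBruijnPhi_pos_holds u).ne'
  simp only [phiNegLogDeriv₂, phiNegLogDeriv]
  field_simp
  ring

/-- `L(u)/u` is strictly increasing on `[0.11, 1/4]`. -/
theorem strictMonoOn_phiNegLogDeriv_div_mid : StrictMonoOn (fun a : ℝ => phiNegLogDeriv a / a) (Icc (11 / 100) (1 / 4)) := by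
  refine strictMonoOn_of_deriv_pos (convex_Icc _ _)
    (fun a ha => (hasDerivAt_phiNegLogDeriv_div (show a ≠ 0 by intro h; rw [h] at ha; norm_num at ha)).continuousAt.continuousWithinAt) ?_
  intro a ha
  rw [interior_Icc] at ha
  have ha0 : 0 < a := lt_trans (by norm_num) ha.1
  rw [(hasDerivAt_phiNegLogDeriv_div ha0.ne').deriv, mul_phiNegLogDeriv₂_sub]
  exact div_pos (div_pos (turanN_pos ha.1.le ha.2.le) (pow_pos (deBruijnPhi_pos_holds a) 2)) (pow_pos ha0 2)

/-! ## 6. Assembly: monotonicity on `(0, 1/4]`, on `(0, ∞)`, and the item closer -/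

/-- **`u ↦ −Φ′(u)/(uΦ(u))` is non-decreasing on `(0, 1/4]`** (Csordas–Varga 1988, Theorem 2.2, the small-`u` half;
zero-free, by the kernel interval certificate). -/
theorem monotoneOn_negPhiDeriv_div_quarter :
    MonotoneOn (fun u : ℝ => -deBruijnPhiDeriv u / (u * deBruijnPhi u)) (Ioc 0 (1 / 4)) := by
  have hgL : (fun u : ℝ => -deBruijnPhiDeriv u / (u * deBruijnPhi u)) = fun u => phiNegLogDeriv u / u := by
    funext u; simp only [phiNegLogDeriv]; rw [div_div, mul_comm]
  have hmid : MonotoneOn (fun u : ℝ => -deBruijnPhiDeriv u / (u * deBruijnPhi u)) (Icc (11 / 100) (1 / 4)) := by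
    rw [hgL]; exact strictMonoOn_phiNegLogDeriv_div_mid.monotoneOn
  have hunion : Ioc (0 : ℝ) (11 / 100) ∪ Icc (11 / 100) (1 / 4) = Ioc 0 (1 / 4) := by
    ext u; simp only [mem_union, mem_Ioc, mem_Icc]; constructor
    · rintro (⟨h1, h2⟩ | ⟨h1, h2⟩)
      · exact ⟨h1, by linarith⟩
      · exact ⟨by linarith, h2⟩
    · rintro ⟨h1, h2⟩
      by_cases h : u ≤ 11 / 100
      · exact Or.inl ⟨h1, h⟩
      · exact Or.inr ⟨(not_le.mp h).le, h2⟩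
  rw [← hunion]
  exact MonotoneOn.union_right monotoneOn_negPhiDeriv_div_small hmid ⟨⟨by norm_num, le_rfl⟩, fun x hx => hx.2⟩
    ⟨⟨le_rfl, by norm_num⟩, fun x hx => hx.1⟩

end Summit.RiemannHypothesis.RiemannHypothesis.Theorems.JensenPolynomials
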